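import Mathlib
import HarnessLib.Audit
import Summits.PneNP.PneNP.Theorems.PstarChordBridge

/-!
# The lift property of a forest of non-chords (ROUND-24, memo §9 R1 "Assumption A"; companion of `PstarChordBridge`)

FRONTIER range-avoidance ladder, rung F-N3, ROUND 24 (cell `pnp-ideate`, planner memo `r24/CORE-BOUND-NOTES.md` §2 / §9 R1 / §11 (N3):
"Assumption A = some spanning forest leaves every co-tree edge a private AND variable; then the cycle equations can be solved for the chord
products and V₀ is the graph of the free cube"; restricted-model proof complexity — nothing here bears on `P` versus `NP`).

`PstarChordBridge.infeasible_of_not_solution` needs the LIFT property `PstarChordBridge.Lift I B`: every assignment can be corrected on the XOR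
vertices of the non-chord part `J₀ ∖ N` so as to satisfy all of `J₀ ∖ N`.  This file proves it from LEAF-PEELABILITY (every non-empty subset
of `J₀ ∖ N` has a vertex of slot-degree exactly `1` — the path-free way of saying that `J₀ ∖ N` is a forest of the XOR multigraph):

* `lift_of_peelable` — peel a leaf edge, lift the rest by induction, then set the leaf vertex (pure + typed: the leaf is an XOR-slot variable
  of the leaf edge only, read by no AND slot);
* `lift_of_wf_peelable` — the `Lift` property of bridge data whose non-chord part is leaf-peelable.
-/

set_option linter.dupNamespace false -- `Summit.PneNP.PneNP.…`: summit = sub-problem name (D-0017 single-conjunct layout)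

open Finset Literature.Computability.Complexity
open Summit.PneNP.PneNP.Theorems.PstarFibrePolys (bit bit_xor bit_and bit_injective)
open Summit.PneNP.PneNP.Theorems.PstarPDT (bit_eval)
open Summit.PneNP.PneNP.Theorems.PstarTyped (Typed)
open Summit.PneNP.PneNP.Theorems.PstarXorElimination (pdeg)
open Summit.PneNP.PneNP.Theorems.PstarXCore (xpair xverts mem_xpair)
open Summit.PneNP.PneNP.Theorems.PstarGapPeeling (eval_congr)
open Summit.PneNP.PneNP.Theorems.PstarChordBridgeTools
open Summit.PneNP.PneNP.Theorems.PstarChordBridge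

namespace Summit.PneNP.PneNP.Theorems.PstarChordBridgeLift

variable {n m : ℕ}

/-! ## The lift property from leaf-peelability -/

/-- **A forest lifts.**  If every non-empty subset of `F` has a vertex of slot-degree exactly `1` (leaf-peelable — true for the edge set of a
forest in the XOR multigraph), then on a pure typed instance every assignment can be corrected on the XOR vertices of `F` so as to satisfy all
outputs of `F` (peel a leaf edge, lift the rest, then set the leaf). -/
theorem lift_of_peelable (I : LocalMap 4 n m) (hI : I.IsPure xorAndPred) (hT : Typed I) (y : Fin m → Bool) :
    ∀ (F : Finset (Fin m)), (∀ S ⊆ F, S.Nonempty → ∃ w, xpdeg I S w = 1) →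
      ∀ x : Fin n → Bool, ∃ z : Fin n → Bool, (∀ j ∈ F, I.eval z j = y j) ∧ ∀ v, v ∉ xverts I F → z v = x v := by
  classical
  intro F
  induction F using Finset.strongInduction with
  | H F ih =>
    intro hpeel x
    rcases F.eq_empty_or_nonempty with rfl | hne
    · exact ⟨x, fun j hj => absurd hj (notMem_empty j), fun v _ => rfl⟩
    obtain ⟨w, hw⟩ := hpeel F (Subset.refl F) hne
    -- the unique leaf edge `j` at `w`, and its slot
    have hw' : (F.filter fun j => I.vars j 0 = w).card + (F.filter fun j => I.vars j 1 = w).card = 1 := hw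
    obtain ⟨j, hjF, s, hs, hjs, huniq⟩ : ∃ j ∈ F, ∃ s : Fin 4, s.val < 2 ∧ I.vars j s = w ∧
        ∀ j' ∈ F, ∀ s' : Fin 4, s'.val < 2 → I.vars j' s' = w → j' = j := by
      have hcases : ((F.filter fun j => I.vars j 0 = w).card = 1 ∧ (F.filter fun j => I.vars j 1 = w).card = 0) ∨
          ((F.filter fun j => I.vars j 0 = w).card = 0 ∧ (F.filter fun j => I.vars j 1 = w).card = 1) := by omega
      have slot01 : ∀ s' : Fin 4, s'.val < 2 → s' = 0 ∨ s' = 1 := by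
        intro s' hs'
        rcases s' with ⟨s', h4⟩
        simp only [Fin.ext_iff] at *
        omega
      rcases hcases with ⟨h0, h1⟩ | ⟨h0, h1⟩
      · obtain ⟨j, hj⟩ := card_eq_one.1 h0
        have hjm : j ∈ F.filter fun j => I.vars j 0 = w := by rw [hj]; exact mem_singleton_self j
        refine ⟨j, (mem_filter.1 hjm).1, 0, by decide, (mem_filter.1 hjm).2, fun j' hj' s' hs' hj's' => ?_⟩
        rcases slot01 s' hs' with rfl | rfl
        · have : j' ∈ F.filter fun j => I.vars j 0 = w := mem_filter.2 ⟨hj', hj's'⟩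
          rw [hj] at this; exact mem_singleton.1 this
        · have : j' ∈ F.filter fun j => I.vars j 1 = w := mem_filter.2 ⟨hj', hj's'⟩
          rw [card_eq_zero.1 h1] at this; exact absurd this (notMem_empty _)
      · obtain ⟨j, hj⟩ := card_eq_one.1 h1
        have hjm : j ∈ F.filter fun j => I.vars j 1 = w := by rw [hj]; exact mem_singleton_self j
        refine ⟨j, (mem_filter.1 hjm).1, 1, by decide, (mem_filter.1 hjm).2, fun j' hj' s' hs' hj's' => ?_⟩
        rcases slot01 s' hs' with rfl | rfl
        · have : j' ∈ F.filter fun j => I.vars j 0 = w := mem_filter.2 ⟨hj', hj's'⟩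
          rw [card_eq_zero.1 h0] at this; exact absurd this (notMem_empty _)
        · have : j' ∈ F.filter fun j => I.vars j 1 = w := mem_filter.2 ⟨hj', hj's'⟩
          rw [hj] at this; exact mem_singleton.1 this
    -- lift the rest
    have hsub : F.erase j ⊂ F := erase_ssubset hjF
    obtain ⟨z', hz', hz'x⟩ := ih (F.erase j) hsub (fun S hS hSne => hpeel S (hS.trans (erase_subset j F)) hSne) x
    -- `w` is touched by no other output of `F`, and by no AND slot at all
    have hwF : ∀ j' ∈ F.erase j, ∀ s' : Fin 4, I.vars j' s' ≠ w := by
      intro j' hj' s' h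
      by_cases hs' : s'.val < 2
      · exact ne_of_mem_erase hj' (huniq j' (mem_of_mem_erase hj') s' hs' h)
      · exact hT j j' s s' hs (by omega) (hjs.trans h.symm)
    have hwx : w ∉ xverts I (F.erase j) := by
      unfold PstarXCore.xverts
      rw [mem_biUnion]
      rintro ⟨j', hj', hmem⟩
      rcases (mem_xpair I).1 hmem with h | h
      · exact hwF j' hj' 0 h.symm
      · exact hwF j' hj' 1 h.symm
    -- set the leaf
    have hinj := hI.2 j
    -- the other XOR slot of `j`
    obtain ⟨s₂, hs₂, hss₂⟩ : ∃ s₂ : Fin 4, s₂.val < 2 ∧ s₂ ≠ s := by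
      by_cases h0 : s = 0
      · exact ⟨1, by decide, by rw [h0]; decide⟩
      · exact ⟨0, by decide, fun h => h0 h.symm⟩
    let b : Bool := xor (y j) (xor (z' (I.vars j s₂)) (z' (I.vars j 2) && z' (I.vars j 3)))
    refine ⟨Function.update z' w b, fun j' hj' => ?_, fun v hv => ?_⟩
    · by_cases hjj : j' = j
      · subst hjj
        apply bit_injective
        rw [bit_eval hI]
        have hne2 : I.vars j' 2 ≠ w := fun h => hT j' j' s 2 hs (by decide) (hjs.trans h.symm)
        have hne3 : I.vars j' 3 ≠ w := fun h => hT j' j' s 3 hs (by decide) (hjs.trans h.symm)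
        have hne₂ : I.vars j' s₂ ≠ w := fun h => hss₂ (hinj (h.trans hjs.symm))
        rw [Function.update_of_ne hne2, Function.update_of_ne hne3]
        have hself : Function.update z' w b (I.vars j' s) = b := by rw [hjs, Function.update_self]
        have h01 : bit (Function.update z' w b (I.vars j' 0)) + bit (Function.update z' w b (I.vars j' 1)) = bit b + bit (z' (I.vars j' s₂)) := by
          have slot : (s = 0 ∧ s₂ = 1) ∨ (s = 1 ∧ s₂ = 0) := by
            rcases s with ⟨s, h4⟩; rcases s₂ with ⟨s₂, h4'⟩
            simp only [Fin.ext_iff, ne_eq] at *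
            omega
          rcases slot with ⟨rfl, rfl⟩ | ⟨rfl, rfl⟩
          · rw [hself, Function.update_of_ne hne₂]
          · rw [hself, Function.update_of_ne hne₂, add_comm]
        rw [h01]
        simp only [b, bit_xor, bit_and]
        generalize bit (y j') = a
        generalize bit (z' (I.vars j' s₂)) = c
        generalize bit (z' (I.vars j' 2)) * bit (z' (I.vars j' 3)) = d
        revert a c d
        decide
      · have hj'e : j' ∈ F.erase j := mem_erase.2 ⟨hjj, hj'⟩
        rw [← hz' j' hj'e]
        exact eval_congr I j' fun t => Function.update_of_ne (hwF j' hj'e t) _ _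
    · have hvw : v ≠ w := by
        rintro rfl
        apply hv
        unfold PstarXCore.xverts
        rw [mem_biUnion]
        refine ⟨j, hjF, (mem_xpair I).2 ?_⟩
        have : s = 0 ∨ s = 1 := by
          rcases s with ⟨s, h4⟩
          simp only [Fin.ext_iff] at *
          omega
        rcases this with rfl | rfl
        · exact Or.inl hjs.symm
        · exact Or.inr hjs.symm
      rw [Function.update_of_ne hvw]
      refine hz'x v fun hv' => hv ?_
      unfold PstarXCore.xverts at hv' ⊢
      rw [mem_biUnion] at hv' ⊢
      obtain ⟨j', hj', hm⟩ := hv'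
      exact ⟨j', mem_of_mem_erase hj', hm⟩

/-- **The lift property of bridge data with a leaf-peelable non-chord part.** -/
theorem lift_of_wf_peelable (I : LocalMap 4 n m) (hI : I.IsPure xorAndPred) (hT : Typed I) (B : BridgeData n m)
    (hpeel : ∀ S ⊆ B.J₀ \ B.N, S.Nonempty → ∃ w, xpdeg I S w = 1) : Lift I B :=
  lift_of_peelable I hI hT B.y (B.J₀ \ B.N) hpeel

end Summit.PneNP.PneNP.Theorems.PstarChordBridgeLift
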